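import Literature.NumberTheory.EllipticCurves.RationalTwoTorsionConductorExponentProofs
import Literature.NumberTheory.EllipticCurves.BoxerDiao2010.TamagawaTwistHolds
import Literature.NumberTheory.EllipticCurves.LocalTorsionCohomologyCoprime
import Literature.NumberTheory.EllipticCurves.TorsionLocalKernelRestrictionProofs
import Literature.NumberTheory.EllipticCurves.SelmerLocalConditionGoodReductionProofs
import Literature.NumberTheory.EllipticCurves.HeegnerPointsKolyvaginLocalCriterion
import Literature.NumberTheory.Automorphic.AdicCompletionDegreeOnePlaceProofs
import Literature.NumberTheory.EllipticCurves.StrictSelmerRankOneDegreeOneProofs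
import Summits.BirchSwinnertonDyer.BirchSwinnertonDyer.Theorems.GenusKolyvaginAtTwoEquivariantKolyvaginExactAtTwoCebotarevVisibleRat
import Summits.BirchSwinnertonDyer.BirchSwinnertonDyer.Theorems.CMKolyvaginAtInertTwoRationalDescentAtTwoTower
import HarnessLib

/-!
# Route `GenusKolyvaginAtTwo`, crux L_T `PowDvdShaCardAtTwoRT` (stmt-BirchSwinnertonDyer-23242), LINE 18 bottom rung, (NPh):
# AT AN ODD ADDITIVE PRIME WITH ODD TAMAGAWA NUMBER `E(ℚ_p)[2] = 0`, HENCE `H¹(ℚ_p, E[2^k]) = 0` — such places are SILENT for (NPh)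

Width seat `bsd-line-gk2-p5` g20 (cell `bsd-f1-sign2`, SUPPLY lineage), `--supports stmt-BirchSwinnertonDyer-23242` (helper; closes nothing).
THEOREMS ONLY (no definition, no named fact, no `sorry`); BSD is not proved by any of this.

WHY (LEAD memo `Cruxes/PowDvdShaCardAtTwoRT/Lines/plus-descent-lead-g17.md` §0(C), §3; this seat's memo
`Cruxes/GenusPrimitiveSupplyAtTwo/Lines/habitat-cut-supply-g20.md` §4).  The one residual hypothesis of LINE 18's Čebotarev layer is
(NPh): «no non-zero class of `H¹(K, E[2^M])` dying on `Γ_{K(E[2^M])}` is Selmer at every finite place».  gk2-p3 g22 / the LEAD discharge it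
from an odd MULTIPLICATIVE prime (the Lawson–Wuthrich class is not Kummer there).  On the habitat every odd bad prime `p` has `c_p` odd; if
`p` is ADDITIVE this forces `E(ℚ_p)[2] = 0` (this file, §1–§2: a `ℚ_p`-rational point of order `2` would give an element of order `2` of
`E(ℚ_p)/E₁(ℚ_p)`, a group of order `c_p · #Ẽ_ns(𝔽_p) = c_p · p` — Silverman *AEC* VII.2.1, Ex. 3.5 — since `E₁(ℚ_p)` has no `2`-torsion for odd
`p`, *AEC* VII.3.1), and then Tate's local Euler characteristic gives `H¹(ℚ_p, E[2^k]) = 0` for every `k` (tree, unconditional: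
`Literature/…/LocalTorsionCohomologyCoprime.lean`).  So at such places EVERY class of `H¹(ℚ, E[2^k])` — and the restriction to any number
field `K` of every such class, at every place `w ∣ p` of `K` with `K_w = ℚ_p`… in fact at every `w` over `p` for RESTRICTED classes by
the tree's `…_of_under` transfer — satisfies BOTH the Selmer and the strict local condition: odd additive primes can neither kill a phantom
class nor obstruct it.  Consequence recorded in the memo: on the 10/858 X5 `Δ < 0` instrument rows without an odd multiplicative prime, (NPh) is
a purely `2`-adic question.

* §1 `forall_two_nsmul_eq_zero_padic_of_additive_of_odd` — `W/ℚ` globally minimal elliptic, `p ≠ 2` additive, `c_p` odd ⟹ `E(ℚ_p)[2] = 0`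
  (the tree's `two_dvd_localTamagawaNumber_padic_of_additive_of_hasRationalTwoTorsionX`, run with a LOCAL point of order `2`).
* §2 `odd_localTamagawaNumber_padic_of_odd_tamagawaProduct` — `C(W) = ∏ c_v` odd ⟹ `c_p` odd (`c_p ∣ C(W)`, Boxer–Diao file);
  `forall_two_nsmul_eq_zero_padic_of_additive_of_odd_tamagawaProduct` — §1 on the habitat's hypothesis `Odd W.tamagawaProduct`.
* §3 `forall_two_nsmul_eq_zero_adicCompletion_of_additive_of_odd_tamagawaProduct` — the same for the completion `ℚ_v` at the place `v` of
  `𝓞 ℚ` over `p` (transport along Mathlib's `adicCompletion.padicEquiv v : ℚ_v ≃A[ℚ] ℚ_[p]`, injective on points).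
* §4 `mem_selmerLocalKer_and_mem_torsionLocalKer_of_additive_of_odd_tamagawaProduct` — hence EVERY `c ∈ H¹(ℚ, E[2^k])` lies in
  `selmerLocalKer W ℚ_v (2^k)` AND in `torsionLocalKer W ℚ_v (2^k)` (`H¹(ℚ_v, E[2^k]) = 0`);
  `resTorsion_mem_selmerLocalKer_and_mem_torsionLocalKer_of_additive_of_odd_tamagawaProduct` — and for every number field `K` and every
  place `w` of `K` over `p`, `res_K c` lies in both local kernels of `E_K` at `w` (tree `…_of_under` transfers) — the (NPh) currency of
  `RelaxedCount.false_of_bottomRung_engine_cheb` for restricted classes such as the Lawson–Wuthrich phantom `ι φ₂|_K = res_K φ₄`.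

* §5 `mem_selmerLocalKer_of_forall_h1Eval_eq_zero_of_hasGoodReductionAt` — the companion at GOOD places `v ∤ n` of any number field: a
  class of `H¹(K, E[n])` whose chosen cocycle vanishes on `Γ_{K(E[n])}` (a «phantom» class, the (NPh) premise) is Selmer at `v`, because
  inertia at a good place `v ∤ n` fixes `E[n]` (tree `inertia_le_torsionFixing`) and «Selmer at good `v ∤ n`» is «unramified» (Gross 1991
  (7.1)/(7.4), tree `oneCocycleClass_mem_selmerLocalKer_iff`).  With §4 this leaves, for a phantom class on a curve all of whose odd bad
  primes are additive with odd `c_p`, only the places over `2` (and the multiplicative ones, gk2-p3 g22's kill) to decide (NPh).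
* §6 `forall_two_nsmul_eq_zero_baseChange_adicCompletion_of_degree_one`, `mem_selmerLocalKer_and_mem_torsionLocalKer_baseChange_of_degree_one`,
  `mem_selmerLocalKer_and_mem_torsionLocalKer_baseChange_of_split` — the same for EVERY class of `H¹(K, E_K[2^k])` (restricted or not) at a
  place `w` of a number field `K` over `p` of DEGREE ONE (`e = f = 1`, e.g. `p` split in a quadratic `K` — automatic for `p ∣ N` under the
  Heegner hypothesis): `K_w ≅ ℚ_v` (tree `exists_ringEquiv_adicCompletion_of_ramificationIdx_eq_one_of_inertiaDeg_eq_one`) carries `E(ℚ_v)[2] = 0`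
  to `E_K(K_w)[2] = 0`.  This is literally the (NPh) currency (`galH1Torsion (W.baseChange K) (2^k)`, `selmerLocalKer (W.baseChange K) (w.adicCompletion K)`).

References: [SilvermanAEC2009] VII.2 Prop. 2.1, VII.3 Prop. 3.1, VII.4 Prop. 4.1, Thm. VII.6.1, Exercise 3.5, Cor. X.4.4; [MilneADT2006] I
Cor. 2.3, Thm. 2.8, Prop. 3.8; [LawsonWuthrich2016] Lemma 6; [GrossLMS1991] Prop. 6.2 (1), §7 (7.1), (7.4).
-/

set_option linter.dupNamespace false -- tree convention: `Summit.BirchSwinnertonDyer.BirchSwinnertonDyer.Theorems` (summit = sub-problem)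
set_option autoImplicit false

noncomputable section

open scoped Classical

namespace Summit.BirchSwinnertonDyer.BirchSwinnertonDyer.Theorems.GenusExact.NonPhantom

open WeierstrassCurve IsDedekindDomain NumberField Rat.HeightOneSpectrum
open Literature.NumberTheory.EllipticCurves
open Summit.BirchSwinnertonDyer.BirchSwinnertonDyer.Theorems.GenusExact.VisiblePairAtTwo
  (natCast_mem_primesEquiv_symm natCast_prime_mem_iff_eq ofNat_two_notMem_of_ne)

variable (W : WeierstrassCurve ℚ) [W.IsElliptic] [W.IsGloballyMinimal] (p : ℕ) [hp : Fact p.Prime]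

/-! ## §1 `c_p` odd at an odd additive prime forces `E(ℚ_p)[2] = 0` -/

/-- **At an odd additive prime with odd Tamagawa number `E(ℚ_p)` has no point of order `2`.** For `W/ℚ` globally minimal elliptic, an
odd prime `p` at which `W` is neither good nor multiplicative, and `c_p = [E(ℚ_p) : E₀(ℚ_p)]` odd: every `T ∈ E(ℚ_p)` with `2T = O` is `O`.
Proof (Silverman *AEC* VII.2.1, VII.3.1, Ex. 3.5, as in the tree's `two_dvd_localTamagawaNumber_padic_of_additive_of_hasRationalTwoTorsionX`,
run with a LOCAL point): `E₁(ℚ_p)` has no `2`-torsion (`p` odd), so a point of order `2` maps to an element of order `2` of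
`E(ℚ_p)/E₁(ℚ_p)`, whose order is `c_p · #Ẽ_ns(𝔽_p) = c_p · p` — odd. [cite: SilvermanAEC2009, VII.2 Prop. 2.1, VII.3 Prop. 3.1 and Exercise 3.5] -/
theorem forall_two_nsmul_eq_zero_padic_of_additive_of_odd (hp2 : p ≠ 2)
    (hng : ¬ W.HasGoodReductionAtPrime p) (hnm : ¬ W.HasMultiplicativeReductionAtPrime p)
    (hodd : Odd ((W.baseChange ℚ_[p]).localTamagawaNumber ℤ_[p])) :
    ∀ T : (W.baseChange ℚ_[p]).toAffine.Point, 2 • T = 0 → T = 0 := by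
  haveI : (W.baseChange ℚ_[p]).IsMinimal ℤ_[p] := isMinimal_map_padic_of_isGloballyMinimal W p
  haveI : (W.baseChange ℚ_[p]).IsElliptic := by rw [baseChange]; infer_instance
  intro T hT
  by_contra hT0
  set F1 := (W.baseChange ℚ_[p]).formalFiltration 1 with hF1
  set c := (W.baseChange ℚ_[p]).localTamagawaNumber ℤ_[p] with hc
  haveI hfi : F1.FiniteIndex := (W.baseChange ℚ_[p]).finiteIndex_formalFiltration 1
  have hidx : F1.index = c * p := index_formalFiltration_one_of_additive W p hng hnm
  set G := (W.baseChange ℚ_[p]).toAffine.Point ⧸ F1 with hG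
  have hcardG : Nat.card G = c * p := hidx
  have hnd : ¬ p ∣ 2 := fun h ↦ hp2 ((Nat.prime_dvd_prime_iff_eq hp.out Nat.prime_two).mp h)
  -- the image `g` of `T` in `G = E(ℚ_p)/E₁(ℚ_p)` is a genuine element of order `2`
  set g : G := QuotientAddGroup.mk' F1 T with hg
  have hg0 : g ≠ 0 := by
    intro h0
    have hmem : T ∈ F1 := by
      rw [hg, QuotientAddGroup.mk'_apply, QuotientAddGroup.eq_zero_iff] at h0
      exact h0
    have hker : (W.baseChange ℚ_[p]).IsInReductionKernel T := hmem.1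
    exact hT0 ((W.baseChange ℚ_[p]).eq_zero_of_nsmul_eq_zero_of_isInReductionKernel hnd hker hT)
  have h2g : (2 : ℕ) • g = 0 := by rw [hg, ← map_nsmul, hT, map_zero]
  have hord : addOrderOf g = 2 := addOrderOf_eq_prime h2g hg0
  have h2G : 2 ∣ Nat.card G := hord ▸ addOrderOf_dvd_natCard g
  rw [hcardG] at h2G
  have h2c : 2 ∣ c := (Nat.coprime_two_left.mpr (hp.out.odd_of_ne_two hp2)).dvd_of_dvd_mul_right h2G
  exact (Nat.not_even_iff_odd.mpr hodd) (even_iff_two_dvd.mpr h2c)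

/-! ## §2 On the habitat: `C(W)` odd -/

omit [W.IsGloballyMinimal] in
/-- `C(W) = ∏_v c_v` odd ⟹ `c_p` odd (`c_p ∣ C(W)`, tree `BoxerDiao2010.localTamagawaNumber_padic_dvd_tamagawaProduct`).
[cite: SilvermanAEC2009, Cor. VII.6.2] -/
theorem odd_localTamagawaNumber_padic_of_odd_tamagawaProduct (hT : Odd W.tamagawaProduct) :
    Odd ((W.baseChange ℚ_[p]).localTamagawaNumber ℤ_[p]) :=
  hT.of_dvd_nat (BoxerDiao2010.localTamagawaNumber_padic_dvd_tamagawaProduct W p)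

/-- **Habitat form of §1**: `W/ℚ` globally minimal elliptic with `C(W)` odd, `p ≠ 2` additive ⟹ `E(ℚ_p)[2] = 0`.
[cite: SilvermanAEC2009, VII.2 Prop. 2.1, VII.3 Prop. 3.1 and Exercise 3.5] -/
theorem forall_two_nsmul_eq_zero_padic_of_additive_of_odd_tamagawaProduct (hp2 : p ≠ 2)
    (hng : ¬ W.HasGoodReductionAtPrime p) (hnm : ¬ W.HasMultiplicativeReductionAtPrime p) (hT : Odd W.tamagawaProduct) :
    ∀ T : (W.baseChange ℚ_[p]).toAffine.Point, 2 • T = 0 → T = 0 :=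
  forall_two_nsmul_eq_zero_padic_of_additive_of_odd W p hp2 hng hnm
    (odd_localTamagawaNumber_padic_of_odd_tamagawaProduct W p hT)

/-! ## §3 The same over the completion `ℚ_v` at the place over `p` -/

/-- **`E(ℚ_v)[2] = 0` at the place `v` of `ℚ` over an odd additive prime with `C(W)` odd** — §2 transported along Mathlib's continuous
`ℚ`-algebra isomorphism `adicCompletion.padicEquiv v : ℚ_v ≃A[ℚ] ℚ_[p]` (the induced map on points is an injective homomorphism,
`Affine.Point.map_injective`). [cite: SilvermanAEC2009, VII.2 Prop. 2.1, VII.3 Prop. 3.1 and Exercise 3.5] -/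
theorem forall_two_nsmul_eq_zero_adicCompletion_of_additive_of_odd_tamagawaProduct (hp2 : p ≠ 2)
    (hng : ¬ W.HasGoodReductionAtPrime p) (hnm : ¬ W.HasMultiplicativeReductionAtPrime p) (hT : Odd W.tamagawaProduct)
    (v : HeightOneSpectrum (𝓞 ℚ)) (hv : (primesEquiv v : ℕ) = p) :
    ∀ T : (W.baseChange (v.adicCompletion ℚ)).toAffine.Point, 2 • T = 0 → T = 0 := by
  subst hv
  intro T h2T
  set ψ : v.adicCompletion ℚ →ₐ[ℚ] ℚ_[(primesEquiv v : ℕ)] := (adicCompletion.padicEquiv v).toAlgEquiv.toAlgHom with hψ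
  set f := Affine.Point.map (W' := W.toAffine) ψ with hf
  have hinj : Function.Injective f := Affine.Point.map_injective (W' := W.toAffine) (f := ψ)
  have h2 : (2 : ℕ) • f T = 0 := by rw [← map_nsmul, h2T, map_zero]
  have h0 : f T = 0 := forall_two_nsmul_eq_zero_padic_of_additive_of_odd_tamagawaProduct W _ hp2 hng hnm hT (f T) h2
  exact hinj (by rw [h0, map_zero])

/-! ## §4 (NPh) currency: every class is Selmer AND strict at such a place -/

/-- **Odd additive primes with odd Tamagawa number are SILENT for every local condition at level `2^k`.** `W/ℚ` globally minimal elliptic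
with `C(W)` odd, `p ≠ 2` additive, `v` the place of `𝓞 ℚ` over `p`, `k ≥ 0`: EVERY `c ∈ H¹(ℚ, E[2^k])` lies in `selmerLocalKer W ℚ_v (2^k)` and
in `torsionLocalKer W ℚ_v (2^k)` — indeed `H¹(ℚ_v, E[2^k]) = 0` by Tate's local Euler characteristic with `E(ℚ_v)[2] = 0` (tree
`WeierstrassCurve.mem_selmerLocalKer_and_mem_torsionLocalKer_adicCompletion_pow`, unconditional). [cite: MilneADT2006, Ch. I, Cor. 2.3 and Thm. 2.8]
[cite: SilvermanAEC2009, VII.2 Prop. 2.1, VII.3 Prop. 3.1] -/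
theorem mem_selmerLocalKer_and_mem_torsionLocalKer_of_additive_of_odd_tamagawaProduct (hp2 : p ≠ 2)
    (hng : ¬ W.HasGoodReductionAtPrime p) (hnm : ¬ W.HasMultiplicativeReductionAtPrime p) (hT : Odd W.tamagawaProduct)
    (v : HeightOneSpectrum (𝓞 ℚ)) (hpv : (p : 𝓞 ℚ) ∈ v.asIdeal) (k : ℕ) (c : galH1Torsion W ((2 ^ k : ℕ) : ℤ)) :
    c ∈ selmerLocalKer W (v.adicCompletion ℚ) ((2 ^ k : ℕ) : ℤ) ∧ c ∈ W.torsionLocalKer (v.adicCompletion ℚ) ((2 ^ k : ℕ) : ℤ) := by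
  have hveq : v = primesEquiv.symm ⟨p, hp.out⟩ := (natCast_prime_mem_iff_eq hp.out v).mp hpv
  have hv : (primesEquiv v : ℕ) = p := by rw [hveq, Equiv.apply_symm_apply]
  have h2v : ((2 : ℕ) : 𝓞 ℚ) ∉ v.asIdeal := by
    rw [Nat.cast_ofNat]
    exact ofNat_two_notMem_of_ne hp.out hp2 hpv
  haveI : NeZero (2 : ℕ) := ⟨two_ne_zero⟩
  exact W.mem_selmerLocalKer_and_mem_torsionLocalKer_adicCompletion_pow v h2v
    (forall_two_nsmul_eq_zero_adicCompletion_of_additive_of_odd_tamagawaProduct W p hp2 hng hnm hT v hv) k c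

/-- **… and so are the places over `p` of any number field, for restricted classes.** With `W, p, C(W)` as above, `K` a number field, `w`
a place of `K` above `p`, and any `c ∈ H¹(ℚ, E[2^k])`: the restriction `res_K c ∈ H¹(K, E_K[2^k])` lies in the Selmer local kernel AND in
the strict local kernel of `E_K` at `w` (tree transfers `KolyvaginRatDescentTwo.resTorsion_mem_selmerLocalKer_of_under`,
`resTorsion_mem_torsionLocalKer_of_under`). In (NPh) currency (`RelaxedCount.false_of_bottomRung_engine_cheb`): a restricted phantom class —
e.g. the Lawson–Wuthrich class `ι φ₂|_K = res_K φ₄` — is automatically Selmer at every place of `K` over an odd additive prime, and cannot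
be killed there. [cite: MilneADT2006, Ch. I, Cor. 2.3 and Thm. 2.8] [cite: LawsonWuthrich2016, Lemma 6] -/
theorem resTorsion_mem_selmerLocalKer_and_mem_torsionLocalKer_of_additive_of_odd_tamagawaProduct (hp2 : p ≠ 2)
    (hng : ¬ W.HasGoodReductionAtPrime p) (hnm : ¬ W.HasMultiplicativeReductionAtPrime p) (hT : Odd W.tamagawaProduct)
    (K : Type) [Field K] [NumberField K] (w : HeightOneSpectrum (𝓞 K)) (hw : (p : 𝓞 K) ∈ w.asIdeal)
    (k : ℕ) (c : galH1Torsion W ((2 ^ k : ℕ) : ℤ)) :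
    resTorsion W K ((2 ^ k : ℕ) : ℤ) c ∈ selmerLocalKer (W.baseChange K) (w.adicCompletion K) ((2 ^ k : ℕ) : ℤ) ∧
      resTorsion W K ((2 ^ k : ℕ) : ℤ) c ∈ (W.baseChange K).torsionLocalKer (w.adicCompletion K) ((2 ^ k : ℕ) : ℤ) := by
  -- the place `v = w ∩ ℚ` of `𝓞 ℚ` lies over `p`
  have hpv : (p : 𝓞 ℚ) ∈ (w.under (𝓞 ℚ)).asIdeal := by
    change (p : 𝓞 ℚ) ∈ w.asIdeal.under (𝓞 ℚ)
    rw [Ideal.under_def, Ideal.mem_comap, map_natCast]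
    exact hw
  obtain ⟨hsel, htor⟩ :=
    mem_selmerLocalKer_and_mem_torsionLocalKer_of_additive_of_odd_tamagawaProduct W p hp2 hng hnm hT (w.under (𝓞 ℚ)) hpv k c
  exact ⟨KolyvaginRatDescentTwo.resTorsion_mem_selmerLocalKer_of_under K W _ w hsel,
    resTorsion_mem_torsionLocalKer_of_under W K _ w htor⟩

/-! ## §5 The companion at good places: phantom classes are Selmer there -/

omit hp in
/-- **A phantom class is Selmer at every good place `v ∤ n`.** For an elliptic curve `E/K` over a number field (model `V`), a finite place
`v` of good reduction with `(n) ⊄ v`, and a class `z ∈ H¹(K, E[n])` whose chosen cocycle vanishes on `Γ_{K(E[n])}` (`[z, ρ] = 0` for all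
`ρ ∈ torsionFixing V n` — the premise of (NPh)): `z ∈ selmerLocalKer V K_v n`.  Proof: the inertia group of a prime above `v` lies in
`Γ_{K(E[n])}` (`E[n]` is unramified at `v`, Silverman *AEC* VII.4.1; tree `inertia_le_torsionFixing`), so the cocycle vanishes on inertia,
which at a good place `v ∤ n` is the Selmer condition (Gross 1991 (7.1)/(7.4); tree `oneCocycleClass_mem_selmerLocalKer_iff`).
[cite: SilvermanAEC2009, Prop. VII.4.1 and Cor. X.4.4] [cite: GrossLMS1991, §7 (7.1), (7.4)] [cite: MilneADT2006, Ch. I Prop. 3.8] -/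
theorem mem_selmerLocalKer_of_forall_h1Eval_eq_zero_of_hasGoodReductionAt {K : Type} [Field K] [NumberField K]
    (V : WeierstrassCurve K) [V.IsElliptic] {v : HeightOneSpectrum (𝓞 K)} (hv : V.HasGoodReductionAt v) {n : ℤ}
    (hn : (n : 𝓞 K) ∉ v.asIdeal) {z : galH1Torsion V n} (hz : ∀ ρ ∈ torsionFixing V n, h1Eval V n z ρ = 0) :
    z ∈ selmerLocalKer V (v.adicCompletion K) n := by
  have hvbad : v ∉ V.badPlaces (𝓞 K) := fun h ↦ (V.mem_badPlaces_iff v).mp h hv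
  obtain ⟨𝔐, h𝔐⟩ := v.localPrimesAbove_nonempty
  have h𝔓 : v.primeBelow (closureEmb (K := K) (v.adicCompletion K)) 𝔐 ∈ v.primesAbove :=
    HeightOneSpectrum.primeBelow_mem_primesAbove h𝔐
  rw [← oneCocycleClass_reprCocycle V n z]
  refine (V.oneCocycleClass_mem_selmerLocalKer_iff hv hn h𝔓 (reprCocycle V n z)).mpr fun τ hτ ↦ ?_
  exact hz τ (inertia_le_torsionFixing V hvbad hn _ h𝔐 hτ)

/-! ## §6 Places of DEGREE ONE of a number field over such a prime: every class of `H¹(K, E_K[2^k])` is Selmer and strict -/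

/-- **`E_K(K_w)[2] = 0` at a degree-one place over an odd additive prime with `C(W)` odd.** `W/ℚ` globally minimal elliptic with
`C(W)` odd, `p ≠ 2` additive for `W`, `K` a number field, `w` a place of `K` over `p` with `e(w|p) = f(w|p) = 1` (e.g. `p` split in a
quadratic `K`): the base change `E_K` has no `K_w`-point of order `2`.  Proof: `K_w ≅ ℚ_v` (`v = w ∩ ℚ`; tree
`exists_ringEquiv_adicCompletion_of_ramificationIdx_eq_one_of_inertiaDeg_eq_one`, the local degree formula in degree one), points are carried
injectively along the inverse isomorphism, and `E(ℚ_v)[2] = 0` (§3). [cite: SilvermanAEC2009, VII.2 Prop. 2.1, VII.3 Prop. 3.1 and Exercise 3.5]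
[cite: CasselsFrohlich1967, Ch. II §10] -/
theorem forall_two_nsmul_eq_zero_baseChange_adicCompletion_of_degree_one (hp2 : p ≠ 2)
    (hng : ¬ W.HasGoodReductionAtPrime p) (hnm : ¬ W.HasMultiplicativeReductionAtPrime p) (hT : Odd W.tamagawaProduct)
    (K : Type) [Field K] [NumberField K] (w : HeightOneSpectrum (𝓞 K)) (hw : (p : 𝓞 K) ∈ w.asIdeal)
    (he : w.asIdeal.ramificationIdx (𝓞 ℚ) = 1) (hf : w.asIdeal.inertiaDeg (𝓞 ℚ) = 1) :
    ∀ T : ((W.baseChange K).baseChange (w.adicCompletion K)).toAffine.Point, 2 • T = 0 → T = 0 := by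
  set v : HeightOneSpectrum (𝓞 ℚ) := w.under (𝓞 ℚ) with hvdef
  haveI : w.asIdeal.LiesOver v.asIdeal := ⟨rfl⟩
  have hpv : (p : 𝓞 ℚ) ∈ v.asIdeal := by
    change (p : 𝓞 ℚ) ∈ w.asIdeal.under (𝓞 ℚ)
    rw [Ideal.under_def, Ideal.mem_comap, map_natCast]
    exact hw
  have hveq : v = primesEquiv.symm ⟨p, hp.out⟩ := (natCast_prime_mem_iff_eq hp.out v).mp hpv
  have hv : (primesEquiv v : ℕ) = p := by rw [hveq, Equiv.apply_symm_apply]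
  obtain ⟨-, φ, -, -⟩ :=
    Literature.NumberTheory.Automorphic.exists_ringEquiv_adicCompletion_of_ramificationIdx_eq_one_of_inertiaDeg_eq_one ℚ K v w he hf
  -- the base change `E_K ⊗_K K_w` is `E ⊗_ℚ K_w` for the composite `ℚ → K → K_w`
  letI instQKw : Algebra ℚ (w.adicCompletion K) := ((algebraMap K (w.adicCompletion K)).comp (algebraMap ℚ K)).toAlgebra
  have hW : (W.baseChange K).baseChange (w.adicCompletion K) = W.baseChange (w.adicCompletion K) := by
    rw [baseChange, baseChange, baseChange, map_map]
    rfl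
  rw [hW]
  intro T h2T
  set g : w.adicCompletion K →ₐ[ℚ] v.adicCompletion ℚ := (φ.symm : w.adicCompletion K →+* v.adicCompletion ℚ).toRatAlgHom
    with hg
  set f := Affine.Point.map (W' := W.toAffine) g with hfdef
  have hinj : Function.Injective f := Affine.Point.map_injective (W' := W.toAffine) (f := g)
  have h2 : (2 : ℕ) • f T = 0 := by rw [← map_nsmul, h2T, map_zero]
  have h0 : f T = 0 := forall_two_nsmul_eq_zero_adicCompletion_of_additive_of_odd_tamagawaProduct W p hp2 hng hnm hT v hv (f T) h2
  exact hinj (by rw [h0, map_zero])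

/-- **EVERY class of `H¹(K, E_K[2^k])` is Selmer AND strict at a degree-one place over an odd additive prime with `C(W)` odd.** With
`W, p, K, w` as in `forall_two_nsmul_eq_zero_baseChange_adicCompletion_of_degree_one` and any `k`: every
`z ∈ H¹(K, E_K[2^k])` — restricted or not, phantom or not — lies in `selmerLocalKer E_K K_w (2^k)` and in `torsionLocalKer E_K K_w (2^k)`
(`H¹(K_w, E[2^k]) = 0` by Tate's local Euler characteristic, tree `mem_selmerLocalKer_and_mem_torsionLocalKer_adicCompletion_pow`).  This is
the (NPh) currency of `RelaxedCount.false_of_bottomRung_engine_cheb` at the places of `K` over the odd ADDITIVE primes of `N`: no condition there.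
[cite: MilneADT2006, Ch. I, Cor. 2.3 and Thm. 2.8] [cite: SilvermanAEC2009, VII.2 Prop. 2.1, VII.3 Prop. 3.1] -/
theorem mem_selmerLocalKer_and_mem_torsionLocalKer_baseChange_of_degree_one (hp2 : p ≠ 2)
    (hng : ¬ W.HasGoodReductionAtPrime p) (hnm : ¬ W.HasMultiplicativeReductionAtPrime p) (hT : Odd W.tamagawaProduct)
    (K : Type) [Field K] [NumberField K] (w : HeightOneSpectrum (𝓞 K)) (hw : (p : 𝓞 K) ∈ w.asIdeal)
    (he : w.asIdeal.ramificationIdx (𝓞 ℚ) = 1) (hf : w.asIdeal.inertiaDeg (𝓞 ℚ) = 1)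
    (k : ℕ) (z : galH1Torsion (W.baseChange K) ((2 ^ k : ℕ) : ℤ)) :
    z ∈ selmerLocalKer (W.baseChange K) (w.adicCompletion K) ((2 ^ k : ℕ) : ℤ) ∧
      z ∈ (W.baseChange K).torsionLocalKer (w.adicCompletion K) ((2 ^ k : ℕ) : ℤ) := by
  have h2w : ((2 : ℕ) : 𝓞 K) ∉ w.asIdeal := by
    intro h2
    have hpv : (p : 𝓞 ℚ) ∈ (w.under (𝓞 ℚ)).asIdeal := by
      change (p : 𝓞 ℚ) ∈ w.asIdeal.under (𝓞 ℚ)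
      rw [Ideal.under_def, Ideal.mem_comap, map_natCast]
      exact hw
    have h2v : ((2 : ℕ) : 𝓞 ℚ) ∈ (w.under (𝓞 ℚ)).asIdeal := by
      change ((2 : ℕ) : 𝓞 ℚ) ∈ w.asIdeal.under (𝓞 ℚ)
      rw [Ideal.under_def, Ideal.mem_comap, map_natCast]
      exact h2
    rw [Nat.cast_ofNat] at h2v
    exact ofNat_two_notMem_of_ne hp.out hp2 hpv h2v
  haveI : NeZero (2 : ℕ) := ⟨two_ne_zero⟩
  exact (W.baseChange K).mem_selmerLocalKer_and_mem_torsionLocalKer_adicCompletion_pow w h2w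
    (forall_two_nsmul_eq_zero_baseChange_adicCompletion_of_degree_one W p hp2 hng hnm hT K w hw he hf) k z

/-- **Habitat form (Heegner field).** `W/ℚ` globally minimal elliptic with `C(W)` odd; `p ≠ 2` an ADDITIVE prime of `W`; `K` a quadratic
field in which `p` splits (e.g. `K` imaginary quadratic with the Heegner hypothesis for `N_W ∋ p`); `w` a place of `K` over `p`.  Then for
every `k` EVERY class of `H¹(K, E_K[2^k])` is Selmer and strict at `w` — so in LINE 18's (NPh) «no non-zero phantom class is Selmer at every
finite place» the places over the odd additive primes of `N` impose nothing and cannot help; only the places over `2` and over the odd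
multiplicative primes (gk2-p3 g22's kill) matter. [cite: MilneADT2006, Ch. I, Cor. 2.3 and Thm. 2.8] [cite: GrossLMS1991, §1 (Heegner hypothesis)]
[cite: CasselsFrohlich1967, Ch. I §10 Prop. 1] -/
theorem mem_selmerLocalKer_and_mem_torsionLocalKer_baseChange_of_split (hp2 : p ≠ 2)
    (hng : ¬ W.HasGoodReductionAtPrime p) (hnm : ¬ W.HasMultiplicativeReductionAtPrime p) (hT : Odd W.tamagawaProduct)
    (K : Type) [Field K] [NumberField K] (hK2 : Module.finrank ℚ K = 2)
    (hsplit : ((Ideal.span {(p : ℤ)}).primesOver (𝓞 K)).ncard = 2)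
    (w : HeightOneSpectrum (𝓞 K)) (hw : (p : 𝓞 K) ∈ w.asIdeal)
    (k : ℕ) (z : galH1Torsion (W.baseChange K) ((2 ^ k : ℕ) : ℤ)) :
    z ∈ selmerLocalKer (W.baseChange K) (w.adicCompletion K) ((2 ^ k : ℕ) : ℤ) ∧
      z ∈ (W.baseChange K).torsionLocalKer (w.adicCompletion K) ((2 ^ k : ℕ) : ℤ) := by
  obtain ⟨he, hf⟩ := ramificationIdx_eq_one_and_inertiaDeg_eq_one_of_ncard_primesOver_eq_two p hK2 hsplit w hw
  exact mem_selmerLocalKer_and_mem_torsionLocalKer_baseChange_of_degree_one W p hp2 hng hnm hT K w hw he hf k z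

end Summit.BirchSwinnertonDyer.BirchSwinnertonDyer.Theorems.GenusExact.NonPhantom

end
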